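import Summits.CriticalPhenomena.PercolationContinuityZ3.Theorems.PercNearOneGluingNoHeavyLowerTailSunflowerMultiPetalClutterTypeVector
import HarnessLib
import HarnessLib.Audit

/-!
# `NoHeavyLowerTail` (crux stmt-CriticalPhenomena-4575), abstract sunflower cubic, `k` petals: VERTEX IDENTIFICATION for coloured clutters —
# `Q(G/uv)` is the non-separated part of `Q(G)` (`QKW_identFamily`), DOUBLING MONOTONICITY (`QKW_le_QKW_snoc`), and the typed conjecture
# `ClutterIdentificationQK` (CN: identifying two vertices with a common neighbour never increases `Q`), which implies Lemma B for all graphs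

Support file (seat `prim-l12-p2` gen 38; `--supports stmt-CriticalPhenomena-4575`; companion of `…MultiPetalClutterTypeVector` (p386339: `memCount`, `capOf`,
`typeOf`, `pparts`, `qK_lab_eq_lbW`, `QKW_eq_sum_typeCount`), `…MultiPetalTypeUnion` (p385801: `CType`, `lbW`) and `…MultiPetalClutterLemmaB` (p379946:
`ClutterBottomSlackK` = Lemma B).  No `sorry`; nothing is asserted about the crux; the `@[conjecture]` definition is an obligation of the programme, never a fact.
Memo: run/shared/lean/prim/prim-l12/prim-l12-p2/FINDING-g38-VERTEX-IDENTIFICATION.md.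

SETTING.  A family `E : Fin k → Finset α` of nonempty members (a multigraph when all members have two elements); `Q = QKW univ (ofClutter E)` is the Lemma-B
functional (`QKW_eq_sum_typeCount`: `Σ` over ordered 3-partitions of `lbW` of the capped member counts).  For `u ≠ v` the IDENTIFIED FAMILY `G/uv`
(`identFamily u v huv E`, on the subtype `{x // x ≠ v}`) is the image of every member under `v ↦ u` (multiplicities kept).
* `QKW_identFamily` : `QKW univ (ofClutter (G/uv)) = QKWtog univ u v` — the ordered 3-partitions of the quotient are exactly the ordered 3-partitions of `α`
  NOT separating `u` from `v`, with the same capped counts (`memCount_identFamily`); with `QKW_eq_QKWsep_add_QKWtog`:  `Q(G) − Q(G/uv) = QKWsep univ u v`,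
  the sum of the kernel over the partitions SEPARATING `u` from `v`.
* `QKW_le_QKW_snoc` (DOUBLING MONOTONICITY): appending a second copy of any member never decreases `QKW W` (a block containing the duplicated member has its
  cap raised from `1` to `2`, and `lbW` is monotone under such raises, `lbW_le_of_raise`, `decide`); hence `Q(multigraph) ≥ Q(underlying simple graph)`.
* `ClutterIdentificationQK` (CONJECTURE CN, OPEN): for a multigraph and non-adjacent `u ≠ v` with a common neighbour, `0 ≤ QKWsep univ u v`, i.e.
  `Q(G) ≥ Q(G/uv)`.  EVIDENCE (memo §1; exact integer enumeration): every pair with a common neighbour in every graph on ≤ 9 vertices (8 481 691 pairs at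
  n = 9; 0 violations; equality only for a unique common neighbour of degree 2, e.g. `P₃ ⊔ 2K₂`), n = 10 exhaustive and random n ≤ 14 by kit (j233303, j233541),
  multigraphs and marks away from `u, v`; it FAILS without a common neighbour (`2K₂ → P₃`), for marked `u` or `v`, and for hypergraphs with mixed member sizes.
  THEOREM (memo §2, paper): CN ⟹ Lemma B (`ClutterBottomSlackK` restricted to graphs) by induction on the number of vertices — pick non-adjacent `u, v`
  with a common neighbour (else every component is a clique: Lemma B by direct count + THEOREM A), then `Q(G) ≥ Q(G/uv)` [CN, via `QKW_identFamily`]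
  `≥ Q(simple(G/uv))` [`QKW_le_QKW_snoc`] `≥ 0` [induction, one vertex fewer].  The degree-2 case alone gives Lemma B for all series–parallel graphs (memo §3).
  No pointwise (type, port)-refined certificate of CN from Lemma B of sub-configurations + antipodal-Gladkov slices exists (memo §4, four LPs).
-/

namespace Summit.CriticalPhenomena.PercolationContinuityZ3.Theorems.SunflowerPartition

open Finset

variable {α : Type*} [DecidableEq α] [Fintype α] {k : ℕ} (E : Fin k → Finset α)

/-! ## The pointwise form of the type-vector expansion -/

/-- `QKW W = Σ_{q ∈ pparts W} lbW (typeOf E W q)` for a family of nonempty members. [this work] -/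
theorem QKW_eq_sum_pparts_lbW (hne : ∀ i, (E i).Nonempty) (W : Finset α) :
    (MSunflower.ofClutter E).QKW W = ∑ q ∈ pparts W, lbW (typeOf E W q) := by
  rw [QKW_eq_sum_typeCount E hne W]
  have h : ∀ t : CType, lbW t * typeCount E W t = ∑ q ∈ pparts W, (if typeOf E W q = t then lbW t else 0) := by
    intro t
    unfold typeCount
    rw [Finset.natCast_card_filter, Finset.mul_sum]
    refine sum_congr rfl fun q _ => ?_
    split_ifs <;> simp
  simp_rw [h]
  rw [Finset.sum_comm]
  refine sum_congr rfl fun q _ => ?_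
  rw [Finset.sum_ite_eq]
  simp

/-! ## Doubling monotonicity: a duplicated member never decreases `QKW` -/

omit [Fintype α] in
/-- Appending a second copy of the member `E i₀` raises the member count of a block by `1` exactly when the block contains `E i₀`. [this work] -/
theorem memCount_snoc (i₀ : Fin k) (X : Finset α) :
    memCount (Fin.snoc E (E i₀)) X = memCount E X + (if E i₀ ⊆ X then 1 else 0) := by
  unfold memCount
  rw [Finset.card_filter, Finset.card_filter, Fin.sum_univ_castSucc]
  simp only [Fin.snoc_castSucc, Fin.snoc_last]

omit [Fintype α] in
/-- A block containing a member has a positive member count. [this work] -/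
theorem one_le_memCount_of_subset {i₀ : Fin k} {X : Finset α} (h : E i₀ ⊆ X) : 1 ≤ memCount E X := by
  unfold memCount
  exact Finset.card_pos.2 ⟨i₀, mem_filter.2 ⟨mem_univ _, h⟩⟩

/-- `capRaise a b`: `b` equals `a`, or `a ≥ 1` was raised to `b = 2` (Boolean test). [this work] -/
def capRaise (a b : Fin 3) : Bool := (b == a) || ((1 ≤ a.val : Bool) && (b.val == 2))

omit [Fintype α] in
/-- The cap of a block for the family with a duplicated member is a raise of the old cap. [this work] -/
theorem capRaise_capOf_snoc (i₀ : Fin k) (X : Finset α) : capRaise (capOf E X) (capOf (Fin.snoc E (E i₀)) X) = true := by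
  have e : (capOf (Fin.snoc E (E i₀) : Fin (k + 1) → Finset α) X).val = min (memCount E X + (if E i₀ ⊆ X then 1 else 0)) 2 := by
    show min _ 2 = _
    rw [memCount_snoc]
  have ea : (capOf E X).val = min (memCount E X) 2 := rfl
  unfold capRaise
  by_cases h : E i₀ ⊆ X
  · have h1 := one_le_memCount_of_subset E h
    rw [if_pos h] at e
    have e2 : (capOf (Fin.snoc E (E i₀) : Fin (k + 1) → Finset α) X).val = 2 := by rw [e]; omega
    have e1 : 1 ≤ (capOf E X).val := by rw [ea]; omega
    simp [e1, e2]
  · rw [if_neg h, add_zero] at e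
    have hEq : capOf (Fin.snoc E (E i₀) : Fin (k + 1) → Finset α) X = capOf E X := by
      apply Fin.ext; rw [e, ea]
    simp [hEq]

/-- `lbW` is monotone under raising coordinates from `≥ 1` to `2`. [this work] -/
theorem lbW_le_of_raise : ∀ s t : CType, capRaise s.1 t.1 = true → capRaise s.2.1 t.2.1 = true → capRaise s.2.2 t.2.2 = true →
    lbW s ≤ lbW t := by
  decide

/-- **DOUBLING MONOTONICITY.**  For a family of nonempty members, appending a second copy of any member never decreases the bottom-spectator functional of any
sub-cube: `QKW W (ofClutter E) ≤ QKW W (ofClutter (snoc E (E i₀)))`.  Hence `Q(multigraph) ≥ Q(underlying simple graph)`. [this work] -/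
theorem QKW_le_QKW_snoc (hne : ∀ i, (E i).Nonempty) (i₀ : Fin k) (W : Finset α) :
    (MSunflower.ofClutter E).QKW W ≤ (MSunflower.ofClutter (Fin.snoc E (E i₀) : Fin (k + 1) → Finset α)).QKW W := by
  have hne' : ∀ i : Fin (k + 1), ((Fin.snoc E (E i₀) : Fin (k + 1) → Finset α) i).Nonempty := by
    intro i
    refine Fin.lastCases ?_ (fun j => ?_) i
    · rw [Fin.snoc_last]; exact hne i₀
    · rw [Fin.snoc_castSucc]; exact hne j
  rw [QKW_eq_sum_pparts_lbW E hne W, QKW_eq_sum_pparts_lbW _ hne' W]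
  refine sum_le_sum fun q _ => ?_
  unfold typeOf
  exact lbW_le_of_raise _ _ (capRaise_capOf_snoc E i₀ q.1) (capRaise_capOf_snoc E i₀ q.2) (capRaise_capOf_snoc E i₀ _)

/-! ## The separated and non-separated parts of `QKW` -/

namespace MSunflower

variable {E}
variable (F : MSunflower k α)

/-- The part of `QKW W` carried by the ordered 3-partitions of `W` that SEPARATE `u` from `v` (for a graph clutter: `Q(G[W]) − Q(G[W]/uv)`). [this work] -/
def QKWsep (W : Finset α) (u v : α) : ℤ :=
  nested W fun X Y Z => if (u ∈ X ↔ v ∈ X) ∧ (u ∈ Y ↔ v ∈ Y) then 0 else qK k (F.lab X) (F.lab Y) (F.lab Z)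

/-- The complementary part: partitions with `u, v` in a common block. [this work] -/
def QKWtog (W : Finset α) (u v : α) : ℤ :=
  nested W fun X Y Z => if (u ∈ X ↔ v ∈ X) ∧ (u ∈ Y ↔ v ∈ Y) then qK k (F.lab X) (F.lab Y) (F.lab Z) else 0

omit [Fintype α] in
/-- `QKW = QKWsep + QKWtog`. [this work] -/
theorem QKW_eq_QKWsep_add_QKWtog (W : Finset α) (u v : α) : F.QKW W = F.QKWsep W u v + F.QKWtog W u v := by
  unfold QKW QKWsep QKWtog nested
  rw [← sum_add_distrib]
  refine sum_congr rfl fun X _ => ?_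
  rw [← sum_add_distrib]
  refine sum_congr rfl fun Y _ => ?_
  dsimp only
  split_ifs <;> simp

end MSunflower

/-! ## Vertex identification as an image family -/

section Ident

variable {E}
variable (u v : α) (huv : u ≠ v)

omit [Fintype α] in
/-- The identification map `α → {x // x ≠ v}`: `v ↦ u`, every other point to itself. [this work] -/
def identMap (x : α) : {x : α // x ≠ v} := if h : x = v then ⟨u, huv⟩ else ⟨x, h⟩

omit [Fintype α] in
/-- `identMap` on a point different from `v`. [this work] -/
theorem identMap_of_ne {x : α} (hx : x ≠ v) : identMap u v huv x = ⟨x, hx⟩ := by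
  unfold identMap; rw [dif_neg hx]

omit [Fintype α] in
/-- `identMap v = u`. [this work] -/
theorem identMap_v : identMap u v huv v = ⟨u, huv⟩ := by
  unfold identMap; rw [dif_pos rfl]

/-- The preimage of a block of the quotient under the identification map. [this work] -/
def identPre (X' : Finset {x : α // x ≠ v}) : Finset α := univ.filter fun x => identMap u v huv x ∈ X'

/-- Membership in the preimage. [this work] -/
theorem mem_identPre {X' : Finset {x : α // x ≠ v}} {x : α} : x ∈ identPre u v huv X' ↔ identMap u v huv x ∈ X' := by
  unfold identPre; simp

/-- `u` and `v` lie on the same side of every preimage. [this work] -/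
theorem u_mem_identPre_iff (X' : Finset {x : α // x ≠ v}) : u ∈ identPre u v huv X' ↔ v ∈ identPre u v huv X' := by
  rw [mem_identPre, mem_identPre, identMap_of_ne u v huv huv, identMap_v]

/-- Preimages commute with set difference. [this work] -/
theorem identPre_sdiff (X' Y' : Finset {x : α // x ≠ v}) :
    identPre u v huv (X' \ Y') = identPre u v huv X' \ identPre u v huv Y' := by
  ext x; simp only [mem_identPre, mem_sdiff]

/-- The preimage of the full quotient is everything. [this work] -/
theorem identPre_univ : identPre u v huv (univ : Finset {x : α // x ≠ v}) = univ := by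
  ext x; simp only [mem_identPre, mem_univ]

/-- Preimages of disjoint blocks are disjoint. [this work] -/
theorem disjoint_identPre {X' Y' : Finset {x : α // x ≠ v}} (h : Disjoint X' Y') :
    Disjoint (identPre u v huv X') (identPre u v huv Y') := by
  rw [Finset.disjoint_left] at h ⊢
  intro x hx hx'
  exact h ((mem_identPre u v huv).1 hx) ((mem_identPre u v huv).1 hx')

/-- A block of `α` not separating `u` from `v` is the preimage of its restriction. [this work] -/
theorem identPre_subtype (X : Finset α) (hX : u ∈ X ↔ v ∈ X) : identPre u v huv (X.subtype fun x => x ≠ v) = X := by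
  ext x
  rw [mem_identPre, Finset.mem_subtype]
  by_cases hx : x = v
  · subst hx; rw [identMap_v]; exact hX
  · rw [identMap_of_ne u v huv hx]

/-- The restriction of a preimage is the original block. [this work] -/
theorem subtype_identPre (X' : Finset {x : α // x ≠ v}) : (identPre u v huv X').subtype (fun x => x ≠ v) = X' := by
  ext ⟨y, hy⟩
  rw [Finset.mem_subtype, mem_identPre, identMap_of_ne u v huv hy]

/-- The IDENTIFIED FAMILY `G/uv`: the image of every member under the identification map (multiplicities are kept; an edge `{u,v}` would become
the singleton `{u}`). [this work] -/
def identFamily (E : Fin k → Finset α) : Fin k → Finset {x : α // x ≠ v} := fun i => (E i).image (identMap u v huv)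

/-- A member of the identified family lies in a block iff the original member lies in its preimage. [this work] -/
theorem identFamily_subset_iff (E : Fin k → Finset α) (i : Fin k) (X' : Finset {x : α // x ≠ v}) :
    identFamily u v huv E i ⊆ X' ↔ E i ⊆ identPre u v huv X' := by
  unfold identFamily
  rw [Finset.image_subset_iff]
  constructor
  · intro h x hx; exact (mem_identPre u v huv).2 (h x hx)
  · intro h x hx; exact (mem_identPre u v huv).1 (h hx)

/-- Member counts of the identified family are member counts of preimages. [this work] -/
theorem memCount_identFamily (E : Fin k → Finset α) (X' : Finset {x : α // x ≠ v}) :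
    memCount (identFamily u v huv E) X' = memCount E (identPre u v huv X') := by
  unfold memCount
  congr 1
  ext i
  simp only [mem_filter, mem_univ, true_and, identFamily_subset_iff]

/-- Capped counts of the identified family are capped counts of preimages. [this work] -/
theorem capOf_identFamily (E : Fin k → Finset α) (X' : Finset {x : α // x ≠ v}) :
    capOf (identFamily u v huv E) X' = capOf E (identPre u v huv X') := by
  apply Fin.ext
  show min (memCount (identFamily u v huv E) X') 2 = min (memCount E (identPre u v huv X')) 2
  rw [memCount_identFamily]

/-- **`Q(G/uv)` is the non-separated part of `Q(G)`**: for a family of nonempty members, the bottom-spectator functional of the full cube of the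
identified family equals `QKWtog univ u v` of the original family.  Hence `QKW univ − QKW univ (G/uv) = QKWsep univ u v`. [this work] -/
theorem QKW_identFamily (hne : ∀ i, (E i).Nonempty) :
    (MSunflower.ofClutter (identFamily u v huv E)).QKW univ = (MSunflower.ofClutter E).QKWtog univ u v := by
  have hne' : ∀ i, (identFamily u v huv E i).Nonempty := fun i => (hne i).image _
  -- the non-separated part as a double filtered sum
  have hR : (MSunflower.ofClutter E).QKWtog univ u v =
      ∑ X ∈ (univ : Finset α).powerset.filter (fun X => (u ∈ X ↔ v ∈ X)),
        ∑ Y ∈ ((univ : Finset α) \ X).powerset.filter (fun Y => (u ∈ Y ↔ v ∈ Y)),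
          qK k ((MSunflower.ofClutter E).lab X) ((MSunflower.ofClutter E).lab Y) ((MSunflower.ofClutter E).lab ((univ \ X) \ Y)) := by
    unfold MSunflower.QKWtog nested
    rw [Finset.sum_filter]
    refine sum_congr rfl fun X _ => ?_
    rw [Finset.sum_filter]
    by_cases hX : (u ∈ X ↔ v ∈ X)
    · rw [if_pos hX]
      refine sum_congr rfl fun Y _ => ?_
      dsimp only
      by_cases hY : (u ∈ Y ↔ v ∈ Y)
      · rw [if_pos (And.intro hX hY), if_pos hY]
      · rw [if_neg (fun h : (u ∈ X ↔ v ∈ X) ∧ (u ∈ Y ↔ v ∈ Y) => hY h.2), if_neg hY]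
    · rw [if_neg hX]
      refine sum_eq_zero fun Y _ => ?_
      dsimp only
      rw [if_neg (fun h : (u ∈ X ↔ v ∈ X) ∧ (u ∈ Y ↔ v ∈ Y) => hX h.1)]
  rw [hR]
  unfold MSunflower.QKW nested
  -- reindex the outer sum by preimages
  refine Finset.sum_nbij' (fun X' => identPre u v huv X') (fun X => X.subtype fun x => x ≠ v) ?_ ?_ ?_ ?_ ?_
  · intro X' _
    exact mem_filter.2 ⟨mem_powerset.2 (subset_univ _), u_mem_identPre_iff u v huv X'⟩
  · intro X _; exact mem_powerset.2 (subset_univ _)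
  · intro X' _; exact subtype_identPre u v huv X'
  · intro X hX; exact identPre_subtype u v huv X (mem_filter.1 hX).2
  · intro X' _
    -- reindex the inner sum
    refine Finset.sum_nbij' (fun Y' => identPre u v huv Y') (fun Y => Y.subtype fun x => x ≠ v) ?_ ?_ ?_ ?_ ?_
    · intro Y' hY'
      have hsub : Y' ⊆ univ \ X' := mem_powerset.1 hY'
      refine mem_filter.2 ⟨mem_powerset.2 ?_, u_mem_identPre_iff u v huv Y'⟩
      intro x hx
      have hx' := (mem_identPre u v huv).1 hx
      refine mem_sdiff.2 ⟨mem_univ _, fun hxX => ?_⟩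
      exact (mem_sdiff.1 (hsub hx')).2 ((mem_identPre u v huv).1 hxX)
    · intro Y hY
      have hsub : Y ⊆ univ \ identPre u v huv X' := mem_powerset.1 (mem_filter.1 hY).1
      refine mem_powerset.2 fun y hy => ?_
      rw [Finset.mem_subtype] at hy
      refine mem_sdiff.2 ⟨mem_univ _, fun hyX => ?_⟩
      have := (mem_sdiff.1 (hsub hy)).2
      exact this ((mem_identPre u v huv).2 (by rw [identMap_of_ne u v huv y.2]; exact hyX))
    · intro Y' _; exact subtype_identPre u v huv Y'
    · intro Y hY; exact identPre_subtype u v huv Y (mem_filter.1 hY).2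
    · intro Y' hY'
      have hsub : Y' ⊆ univ \ X' := mem_powerset.1 hY'
      have hd12 : Disjoint X' Y' := by
        rw [Finset.disjoint_left]; intro x hx hy; exact (mem_sdiff.1 (hsub hy)).2 hx
      have hd13 : Disjoint X' ((univ \ X') \ Y') := (Finset.disjoint_sdiff).mono_right sdiff_subset
      have hd23 : Disjoint Y' ((univ \ X') \ Y') := Finset.disjoint_sdiff
      have he12 : Disjoint (identPre u v huv X') (identPre u v huv Y') := disjoint_identPre u v huv hd12
      have he13 : Disjoint (identPre u v huv X') ((univ \ identPre u v huv X') \ identPre u v huv Y') :=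
        (Finset.disjoint_sdiff).mono_right sdiff_subset
      have he23 : Disjoint (identPre u v huv Y') ((univ \ identPre u v huv X') \ identPre u v huv Y') := Finset.disjoint_sdiff
      dsimp only
      rw [qK_lab_eq_lbW _ hne' hd12 hd13 hd23, qK_lab_eq_lbW E hne he12 he13 he23,
        capOf_identFamily, capOf_identFamily, capOf_identFamily, identPre_sdiff, identPre_sdiff, identPre_univ]

end Ident

/-! ## The separated part of `QKW` and the vertex-identification conjecture (CN) -/



/-- **VERTEX-IDENTIFICATION CONJECTURE (CN)** (this work; OPEN; evidence in the file header and memo §1): for every finite multigraph — a family of 2-element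
members — and two distinct NON-ADJACENT vertices `u, v` with a COMMON NEIGHBOUR `w`, the separated part of the bottom-spectator functional of the full cube is
nonnegative: `0 ≤ QKWsep univ u v`, i.e. `Q(G) ≥ Q(G/uv)`.  By the memo's THEOREM 1 (doubling monotonicity `QKW_le_QKW_snoc` + induction on the number of
vertices) it implies Lemma B (`0 ≤ QKW univ`) and hence ★ₖ for every graph clutter.  An obligation, never a fact: use as `(h : ClutterIdentificationQK)`. [status: open] -/
@[conjecture] def ClutterIdentificationQK : Prop :=
  ∀ (k : ℕ) (α : Type) [Fintype α] [DecidableEq α] (E : Fin k → Finset α) (u v w : α),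
    (∀ i, (E i).card = 2) → u ≠ v → (∀ i, E i ≠ {u, v}) → (∃ i, E i = {u, w}) → (∃ j, E j = {v, w}) →
      0 ≤ (MSunflower.ofClutter E).QKWsep univ u v

end Summit.CriticalPhenomena.PercolationContinuityZ3.Theorems.SunflowerPartition
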